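import Mathlib
import Summits.Ventures.PercRepro2.LocRows
import Summits.Ventures.PercRepro2.SwRow
import Summits.Ventures.PercRepro2.SwOut
import Summits.Ventures.PercRepro2.SwAllRow
import Summits.Ventures.PercRepro2.SwOutAll
import Summits.Ventures.PercRepro2.SwOutArmFlip
import Summits.Ventures.PercRepro2.SwOutArmThm
import Summits.Ventures.PercRepro2.SwOutCoreDefs
import Summits.Ventures.PercRepro2.SwOutBigBlockDefs
import Summits.Ventures.PercRepro2.SwOutMixedBaseDefs

/-!
# The mixed base: the edge classes are disjoint and the realisation reads them off (blind cell
PercRepro2, night-4 g17, 2026-08-27; proofs/NIGHT4-G17.md §4⁗)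

For a `MixedBase` (SwOutMixedBaseDefs) the five kinds of edge classes — the edges touching a u-arm
`U j`, the edges touching the h-piece `Ah`, the u–p edges, the outside edges of `p`, the edges touching
a far arm `F k` — are pairwise disjoint (`touches_U_disj`, …, `clsExt_not_touches`), so the
realisation `mixedReal σ q` of a point `q` of the raw cube has, on an edge of a class, the base colour
when the class's coordinate is `true` and the opposite colour when it is `false`
(`mixedReal_apply_U`, `mixedReal_apply_Ah`, `mixedReal_apply_UP`, `mixedReal_apply_Ext`,
`mixedReal_apply_F`), and the base colour on an edge of no class (`mixedReal_apply_none`).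
-/

namespace Summit.Ventures.PercRepro2

namespace BigBlock

open Hull LocRows

variable {V : Type*} {E : Type*}

open scoped Classical

section Base

variable {ends : E → Sym2 V} {σ : Config E} {h u p : V} {ι κ : Type*} {U : ι → Set V} {Ah : Set V}
  {F : κ → Set V} (hb : MixedBase ends σ h u p U Ah F)
include hb

/-! ### Disjointness of the classes -/

/-- The classes `touches (U j)` are pairwise disjoint. -/
lemma MixedBase.touches_U_disj {j j' : ι} (hne : j ≠ j') {e : E} (he : e ∈ touches ends (U j)) :
    e ∉ touches ends (U j') := by
  intro he'
  obtain ⟨x, y, hxy, hx, _⟩ := hb.ends_of_touches_U he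
  obtain ⟨x', hx', y', hxy'⟩ := he'
  rw [hxy, Sym2.eq_iff] at hxy'
  rcases hxy' with ⟨h1, _⟩ | ⟨_, h2⟩
  · rw [← h1] at hx'; exact hb.U_disj j j' hne x hx hx'
  · rw [← h2] at hx'; exact hb.no_cross_UU j j' hne e x y hxy hx hx'

/-- `touches (U j)` and `touches Ah` are disjoint. -/
lemma MixedBase.touches_U_Ah_disj {j : ι} {e : E} (he : e ∈ touches ends (U j)) :
    e ∉ touches ends Ah := by
  intro he'
  obtain ⟨x, y, hxy, hx, _⟩ := hb.ends_of_touches_U he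
  obtain ⟨x', hx', y', hxy'⟩ := he'
  rw [hxy, Sym2.eq_iff] at hxy'
  rcases hxy' with ⟨h1, _⟩ | ⟨_, h2⟩
  · rw [← h1] at hx'; exact hb.U_disj_Ah j x hx hx'
  · rw [← h2] at hx'; exact hb.no_cross_UAh j e x y hxy hx hx'

/-- `touches (U j)` and `touches (F k)` are disjoint. -/
lemma MixedBase.touches_U_F_disj {j : ι} {k : κ} {e : E} (he : e ∈ touches ends (U j)) :
    e ∉ touches ends (F k) := by
  intro he'
  obtain ⟨x, y, hxy, hx, _⟩ := hb.ends_of_touches_U he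
  obtain ⟨x', hx', y', hxy'⟩ := he'
  rw [hxy, Sym2.eq_iff] at hxy'
  rcases hxy' with ⟨h1, _⟩ | ⟨_, h2⟩
  · rw [← h1] at hx'; exact hb.U_disj_F j k x hx hx'
  · rw [← h2] at hx'; exact hb.no_cross_UF j k e x y hxy hx hx'

/-- `touches Ah` and `touches (F k)` are disjoint. -/
lemma MixedBase.touches_Ah_F_disj {k : κ} {e : E} (he : e ∈ touches ends Ah) :
    e ∉ touches ends (F k) := by
  intro he'
  obtain ⟨x, y, hxy, hx, _⟩ := hb.ends_of_touches_Ah he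
  obtain ⟨x', hx', y', hxy'⟩ := he'
  rw [hxy, Sym2.eq_iff] at hxy'
  rcases hxy' with ⟨h1, _⟩ | ⟨_, h2⟩
  · rw [← h1] at hx'; exact hb.Ah_disj_F k x hx hx'
  · rw [← h2] at hx'; exact hb.no_cross_AhF k e x y hxy hx hx'

/-- The classes `touches (F k)` are pairwise disjoint. -/
lemma MixedBase.touches_F_disj {k k' : κ} (hne : k ≠ k') {e : E} (he : e ∈ touches ends (F k)) :
    e ∉ touches ends (F k') := by
  intro he'
  obtain ⟨x, y, hxy, hx, _⟩ := hb.ends_of_touches_F he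
  obtain ⟨x', hx', y', hxy'⟩ := he'
  rw [hxy, Sym2.eq_iff] at hxy'
  rcases hxy' with ⟨h1, _⟩ | ⟨_, h2⟩
  · rw [← h1] at hx'; exact hb.F_disj k k' hne x hx hx'
  · rw [← h2] at hx'; exact hb.no_cross_FF k k' hne e x y hxy hx hx'

/-- A u–p edge touches no arm. -/
lemma MixedBase.clsUP_not_touches {e : E} (he : e ∈ clsUP ends u p) :
    (∀ j, e ∉ touches ends (U j)) ∧ e ∉ touches ends Ah ∧ ∀ k, e ∉ touches ends (F k) := by
  have hup : ends e = s(u, p) := he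
  refine ⟨fun j hj => ?_, fun hA => ?_, fun k hk => ?_⟩
  · obtain ⟨x, hx, y, hxy⟩ := hj
    rw [hup, Sym2.eq_iff] at hxy
    rcases hxy with ⟨h1, _⟩ | ⟨_, h2⟩
    · rw [← h1] at hx; exact hb.u_notMem_U j hx
    · rw [← h2] at hx; exact hb.p_notMem_U j hx
  · obtain ⟨x, hx, y, hxy⟩ := hA
    rw [hup, Sym2.eq_iff] at hxy
    rcases hxy with ⟨h1, _⟩ | ⟨_, h2⟩
    · rw [← h1] at hx; exact hb.u_notMem_Ah hx
    · rw [← h2] at hx; exact hb.p_notMem_Ah hx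
  · obtain ⟨x, hx, y, hxy⟩ := hk
    rw [hup, Sym2.eq_iff] at hxy
    rcases hxy with ⟨h1, _⟩ | ⟨_, h2⟩
    · rw [← h1] at hx; exact hb.u_notMem_F k hx
    · rw [← h2] at hx; exact hb.p_notMem_F k hx

/-- An outside edge of `p` touches no arm and is not a u–p edge. -/
lemma MixedBase.clsExt_not_touches {e : E} (he : e ∈ clsExt ends u p Ah) :
    (∀ j, e ∉ touches ends (U j)) ∧ e ∉ touches ends Ah ∧ (∀ k, e ∉ touches ends (F k)) ∧
      e ∉ clsUP ends u p := by
  obtain ⟨z, hpz, hzu, hzA⟩ := he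
  have hz := hb.p_edges e z hpz
  rcases hz with rfl | hz | ⟨hzh, hzp, hzarms⟩
  · exact absurd rfl hzu
  · exact absurd hz hzA
  refine ⟨fun j hj => ?_, fun hA => ?_, fun k hk => ?_, fun hup => ?_⟩
  · obtain ⟨x, hx, y, hxy⟩ := hj
    rw [hpz, Sym2.eq_iff] at hxy
    rcases hxy with ⟨h1, _⟩ | ⟨_, h2⟩
    · rw [← h1] at hx; exact hb.p_notMem_U j hx
    · rw [← h2] at hx; exact hzarms (Or.inl (Or.inl (Set.mem_iUnion.2 ⟨j, hx⟩)))
  · obtain ⟨x, hx, y, hxy⟩ := hA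
    rw [hpz, Sym2.eq_iff] at hxy
    rcases hxy with ⟨h1, _⟩ | ⟨_, h2⟩
    · rw [← h1] at hx; exact hb.p_notMem_Ah hx
    · rw [← h2] at hx; exact hzA hx
  · obtain ⟨x, hx, y, hxy⟩ := hk
    rw [hpz, Sym2.eq_iff] at hxy
    rcases hxy with ⟨h1, _⟩ | ⟨_, h2⟩
    · rw [← h1] at hx; exact hb.p_notMem_F k hx
    · rw [← h2] at hx; exact hzarms (Or.inr (Set.mem_iUnion.2 ⟨k, hx⟩))
  · have hup : ends e = s(u, p) := hup
    rw [hpz, Sym2.eq_iff] at hup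
    rcases hup with ⟨h1, _⟩ | ⟨_, h2⟩
    · exact hb.hne_up h1.symm
    · exact hzu h2

/-! ### The value of the realisation on each class -/

/-- On an edge touching `U j`. -/
lemma MixedBase.mixedReal_apply_U {q : Pt ι κ} {j : ι} {e : E} (he : e ∈ touches ends (U j)) :
    mixedReal ends u p U Ah F σ q e = (if q.1 j = true then σ e else !σ e) := by
  unfold mixedReal
  by_cases hj : q.1 j = true
  · rw [if_pos hj, if_neg]
    rintro ((((⟨j', hj', he'⟩ | ⟨_, he'⟩) | ⟨_, he'⟩) | ⟨_, he'⟩) | ⟨k, _, he'⟩)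
    · by_cases hjj : j = j'
      · subst hjj; rw [hj] at hj'; exact absurd hj' (by decide)
      · exact hb.touches_U_disj hjj he he'
    · exact hb.touches_U_Ah_disj he he'
    · exact (hb.clsUP_not_touches he').1 j he
    · exact (hb.clsExt_not_touches he').1 j he
    · exact hb.touches_U_F_disj he he'
  · rw [if_neg hj, if_pos]
    exact Or.inl (Or.inl (Or.inl (Or.inl ⟨j, by simpa using hj, he⟩)))

/-- On an edge touching `Ah`. -/
lemma MixedBase.mixedReal_apply_Ah {q : Pt ι κ} {e : E} (he : e ∈ touches ends Ah) :
    mixedReal ends u p U Ah F σ q e = (if q.2.1 = true then σ e else !σ e) := by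
  unfold mixedReal
  by_cases ha : q.2.1 = true
  · rw [if_pos ha, if_neg]
    rintro ((((⟨j', _, he'⟩ | ⟨ha', _⟩) | ⟨_, he'⟩) | ⟨_, he'⟩) | ⟨k, _, he'⟩)
    · exact hb.touches_U_Ah_disj he' he
    · rw [ha] at ha'; exact absurd ha' (by decide)
    · exact (hb.clsUP_not_touches he').2.1 he
    · exact (hb.clsExt_not_touches he').2.1 he
    · exact hb.touches_Ah_F_disj he he'
  · rw [if_neg ha, if_pos]
    exact Or.inl (Or.inl (Or.inl (Or.inr ⟨by simpa using ha, he⟩)))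

/-- On a u–p edge. -/
lemma MixedBase.mixedReal_apply_UP {q : Pt ι κ} {e : E} (he : e ∈ clsUP ends u p) :
    mixedReal ends u p U Ah F σ q e = (if q.2.2.1 = true then σ e else !σ e) := by
  unfold mixedReal
  by_cases hc : q.2.2.1 = true
  · rw [if_pos hc, if_neg]
    rintro ((((⟨j', _, he'⟩ | ⟨_, he'⟩) | ⟨hc', _⟩) | ⟨_, he'⟩) | ⟨k, _, he'⟩)
    · exact (hb.clsUP_not_touches he).1 j' he'
    · exact (hb.clsUP_not_touches he).2.1 he'
    · rw [hc] at hc'; exact absurd hc' (by decide)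
    · exact (hb.clsExt_not_touches he').2.2.2 he
    · exact (hb.clsUP_not_touches he).2.2 k he'
  · rw [if_neg hc, if_pos]
    exact Or.inl (Or.inl (Or.inr ⟨by simpa using hc, he⟩))

/-- On an outside edge of `p`. -/
lemma MixedBase.mixedReal_apply_Ext {q : Pt ι κ} {e : E} (he : e ∈ clsExt ends u p Ah) :
    mixedReal ends u p U Ah F σ q e = (if q.2.2.2.1 = true then σ e else !σ e) := by
  unfold mixedReal
  by_cases hc : q.2.2.2.1 = true
  · rw [if_pos hc, if_neg]
    rintro ((((⟨j', _, he'⟩ | ⟨_, he'⟩) | ⟨_, he'⟩) | ⟨hc', _⟩) | ⟨k, _, he'⟩)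
    · exact (hb.clsExt_not_touches he).1 j' he'
    · exact (hb.clsExt_not_touches he).2.1 he'
    · exact (hb.clsExt_not_touches he).2.2.2 he'
    · rw [hc] at hc'; exact absurd hc' (by decide)
    · exact (hb.clsExt_not_touches he).2.2.1 k he'
  · rw [if_neg hc, if_pos]
    exact Or.inl (Or.inr ⟨by simpa using hc, he⟩)

/-- On an edge touching `F k`. -/
lemma MixedBase.mixedReal_apply_F {q : Pt ι κ} {k : κ} {e : E} (he : e ∈ touches ends (F k)) :
    mixedReal ends u p U Ah F σ q e = (if q.2.2.2.2 k = true then σ e else !σ e) := by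
  unfold mixedReal
  by_cases hk : q.2.2.2.2 k = true
  · rw [if_pos hk, if_neg]
    rintro ((((⟨j', _, he'⟩ | ⟨_, he'⟩) | ⟨_, he'⟩) | ⟨_, he'⟩) | ⟨k', hk', he'⟩)
    · exact hb.touches_U_F_disj he' he
    · exact hb.touches_Ah_F_disj he' he
    · exact (hb.clsUP_not_touches he').2.2 k he
    · exact (hb.clsExt_not_touches he').2.2.1 k he
    · by_cases hkk : k = k'
      · subst hkk; rw [hk] at hk'; exact absurd hk' (by decide)
      · exact hb.touches_F_disj hkk he he'
  · rw [if_neg hk, if_pos]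
    exact Or.inr ⟨k, by simpa using hk, he⟩

omit hb in
/-- On an edge in no class. -/
lemma MixedBase.mixedReal_apply_none {q : Pt ι κ} {e : E} (hU : ∀ j, e ∉ touches ends (U j))
    (hA : e ∉ touches ends Ah) (hUP : e ∉ clsUP ends u p) (hX : e ∉ clsExt ends u p Ah)
    (hF : ∀ k, e ∉ touches ends (F k)) : mixedReal ends u p U Ah F σ q e = σ e := by
  unfold mixedReal
  rw [if_neg]
  rintro ((((⟨j, _, he⟩ | ⟨_, he⟩) | ⟨_, he⟩) | ⟨_, he⟩) | ⟨k, _, he⟩)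
  · exact hU j he
  · exact hA he
  · exact hUP he
  · exact hX he
  · exact hF k he

end Base

end BigBlock

end Summit.Ventures.PercRepro2
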